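import Summits.BirchSwinnertonDyer.BirchSwinnertonDyer.Theorems.AlignedTransportAtTwoMainConjectureOfRankZeroBSDAtTwoCubicTowerJumps
import Literature.NumberTheory.IwasawaTheory.ClassicalLambdaInvariant
import HarnessLib

/-!
# Route `AlignedTransportAtTwo`, crux C2 `MainConjectureOfRankZeroBSDAtTwo` (stmt-BirchSwinnertonDyer-22298):
# `μ₂ = 0 ⟹ λ₂ ≥ 1` FOR THE KILFORD CUBIC FIELDS, in the tree's `λ`-currency `IwasawaTheory.classicalLambda`

HONEST FRAMING (cell `bsd-f1-sign2`, WIDTH-5 attached prover seat `bsd-line-att-p3` gen 25 on line `birth` of the lead `bsd-line-att-p2`;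
`--supports` stmt-BirchSwinnertonDyer-22298, closes nothing; BSD is NOT proved by any of this; the crux C2, its verdict «blocked-on
`Rank1Residual.GreenbergMuConjectureIrreducible`» and every registered stub are untouched). THEOREMS ONLY — no definition, no named fact,
no `sorry`. Fifth file of this seat's «Chevalley along the whole tower»: `…CubicTowerJumps.one_le_slope_of_linear_growth` (any eventual law
`e_n = l·n + ν` has `l ≥ 1`) read on the tree's DEFINITION `classicalLambda κ` (the slope of the growth form under `ClassicalMuVanishes κ`,
junk `0` otherwise; `classicalLambda_spec`, `eq_classicalLambda_of_growth`):

* `one_le_classicalLambda_of_classicalMuVanishes` — `K` of odd degree and unit rank `1`, `κ` cyclotomic, all places above `2` of odd index and at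
  least three of them: **`ClassicalMuVanishes κ → 1 ≤ classicalLambda κ`**;
* `classicalMuVanishes_iff_one_le_classicalLambda` — there `μ = 0 ⟺ λ ≥ 1` (the junk value `0` is taken exactly when `μ ≠ 0`);
* `one_le_classicalLambda_of_cubic` — complex cubic field with three places above `2`;
* `one_le_classicalLambda_seedCubicField` — the cubic `2`-torsion field `ℚ(β)` of a seed-cell curve with `Δ_W < 0` and three places above `2` in `ℚ(β)`
  (all twelve certified seeds): H3M⁻ («`μ₂(ℚ(β)^{cyc}) = 0`») FORCES `λ₂(ℚ(β)^{cyc}) ≥ 1` — these towers are never `λ = 0` towers (the cubic analogue of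
  «`λ_p ≥ 1` for an imaginary quadratic field in which `p` splits»).

References: [Lang1990] Ch. 5 §1 Thm. 1.2, Ch. 13 §4 Lemma 4.1; [Washington1997] §13.3 Thm. 13.13; [Fukuda1994] Thm. 1 (1); tree
`ClassicalLambdaInvariant`, `…CubicTowerGrowth`, `…CubicTowerJumps`.
-/

set_option linter.dupNamespace false
set_option autoImplicit false

noncomputable section

open scoped Classical NumberField nonZeroDivisors

namespace Summit.BirchSwinnertonDyer.BirchSwinnertonDyer.Theorems.AlignedTransportAtTwoCubicTowerLambda

open NumberField IsDedekindDomain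
open Literature.NumberTheory.NumberFields Literature.NumberTheory.GaloisRepresentations Literature.NumberTheory.IwasawaTheory
  Literature.NumberTheory.EllipticCurves
  Summit.BirchSwinnertonDyer.BirchSwinnertonDyer.Theorems.AddKatoTwo
  Summit.BirchSwinnertonDyer.BirchSwinnertonDyer.Theorems.AlignedTransportAtTwoCubicLayerOneParity
  Summit.BirchSwinnertonDyer.BirchSwinnertonDyer.Theorems.AlignedTransportAtTwoCubicLayerOneDoors
  Summit.BirchSwinnertonDyer.BirchSwinnertonDyer.Theorems.AlignedTransportAtTwoCubicTowerGrowth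
  Summit.BirchSwinnertonDyer.BirchSwinnertonDyer.Theorems.AlignedTransportAtTwoCubicTowerJumps

section Generic

variable {K : Type} [Field K] [NumberField K]

/-- **`μ = 0 ⟹ λ ≥ 1`** in the tree's `λ`-currency: `K` of odd degree and unit rank `1`, `κ` cyclotomic, all places above `2` of odd index, at least
three of them; if `ClassicalMuVanishes κ` then `1 ≤ classicalLambda κ` (`classicalLambda_spec` + `…CubicTowerJumps.one_le_slope_of_linear_growth`).
[cite: Lang1990, Ch. 5 §1 Thm. 1.2 and Ch. 13 §4 Lemma 4.1] [cite: Washington1997, §13.3 Thm. 13.13] -/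
theorem one_le_classicalLambda_of_classicalMuVanishes (hK2 : ¬ 2 ∣ Module.finrank ℚ K) (hrank : Units.rank K = 1)
    (κ : ZpExtension K 2) (hκ : κ.IsCyclotomic)
    (hodd : ∀ w : HeightOneSpectrum (𝓞 K), ((2 : ℕ) : 𝓞 K) ∈ w.asIdeal → Odd (w.asIdeal.ramificationIdx ℤ))
    (h3 : 3 ≤ {w : HeightOneSpectrum (𝓞 K) | ((2 : ℕ) : 𝓞 K) ∈ w.asIdeal}.ncard) (hμ : ClassicalMuVanishes κ) :
    1 ≤ classicalLambda κ := by
  obtain ⟨ν, n₀, h⟩ := classicalLambda_spec κ hμ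
  exact one_le_slope_of_linear_growth hK2 hrank κ hκ hodd h3 h

/-- **`μ = 0 ⟺ λ ≥ 1`** for such towers, in the tree's currency (`classicalLambda κ` is the junk value `0` exactly when `ClassicalMuVanishes κ`
fails, `classicalLambda_eq_zero_of_not_classicalMuVanishes`). [cite: Lang1990, Ch. 5 §1 Thm. 1.2] [cite: Washington1997, §13.3 Thm. 13.13] -/
theorem classicalMuVanishes_iff_one_le_classicalLambda (hK2 : ¬ 2 ∣ Module.finrank ℚ K) (hrank : Units.rank K = 1)
    (κ : ZpExtension K 2) (hκ : κ.IsCyclotomic)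
    (hodd : ∀ w : HeightOneSpectrum (𝓞 K), ((2 : ℕ) : 𝓞 K) ∈ w.asIdeal → Odd (w.asIdeal.ramificationIdx ℤ))
    (h3 : 3 ≤ {w : HeightOneSpectrum (𝓞 K) | ((2 : ℕ) : 𝓞 K) ∈ w.asIdeal}.ncard) :
    ClassicalMuVanishes κ ↔ 1 ≤ classicalLambda κ := by
  refine ⟨one_le_classicalLambda_of_classicalMuVanishes hK2 hrank κ hκ hodd h3, fun h => ?_⟩
  by_contra hμ
  have := classicalLambda_eq_zero_of_not_classicalMuVanishes κ hμ
  omega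

end Generic

section Cubic

variable (F : Type) [Field F] [NumberField F]

/-- **`μ₂(F^{cyc}) = 0 ⟹ λ₂(F^{cyc}) ≥ 1`** for a complex cubic field `F` (one real place) with three places above `2`, every cyclotomic `κ`.
[cite: Lang1990, Ch. 5 §1 Thm. 1.2 and Ch. 13 §4 Lemma 4.1] [cite: Washington1997, §13.3 Thm. 13.13] -/
theorem one_le_classicalLambda_of_cubic (hF : Module.finrank ℚ F = 3) (h1 : InfinitePlace.nrRealPlaces F = 1)
    (h3 : 3 ≤ {v : HeightOneSpectrum (𝓞 F) | ((2 : ℕ) : 𝓞 F) ∈ v.asIdeal}.ncard)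
    (κ : ZpExtension F 2) (hκ : κ.IsCyclotomic) (hμ : ClassicalMuVanishes κ) : 1 ≤ classicalLambda κ :=
  one_le_classicalLambda_of_classicalMuVanishes (by rw [hF]; norm_num) (units_rank_eq_one_of_nrRealPlaces_eq_one F hF h1) κ hκ
    (fun w hw => by rw [ramificationIdx_eq_one_of_three_le_ncard F hF h3 w hw]; exact odd_one) h3 hμ

/-- `μ = 0 ⟺ λ ≥ 1` in the tree's currency for such `F`. [cite: Lang1990, Ch. 5 §1 Thm. 1.2] [cite: Washington1997, §13.3 Thm. 13.13] -/
theorem classicalMuVanishes_iff_one_le_classicalLambda_of_cubic (hF : Module.finrank ℚ F = 3) (h1 : InfinitePlace.nrRealPlaces F = 1)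
    (h3 : 3 ≤ {v : HeightOneSpectrum (𝓞 F) | ((2 : ℕ) : 𝓞 F) ∈ v.asIdeal}.ncard)
    (κ : ZpExtension F 2) (hκ : κ.IsCyclotomic) : ClassicalMuVanishes κ ↔ 1 ≤ classicalLambda κ :=
  classicalMuVanishes_iff_one_le_classicalLambda (by rw [hF]; norm_num) (units_rank_eq_one_of_nrRealPlaces_eq_one F hF h1) κ hκ
    (fun w hw => by rw [ramificationIdx_eq_one_of_three_le_ncard F hF h3 w hw]; exact odd_one) h3

end Cubic

section Seed

open WeierstrassCurve Polynomial IntermediateField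
  Literature.NumberTheory.EllipticCurves.Greenberg1999
  Summit.BirchSwinnertonDyer.Rank1Residual

variable (W : WeierstrassCurve ℚ) [W.IsElliptic]

/-- **H3M⁻ forces `λ₂ ≥ 1` on the Kilford seeds.** `W/ℚ` elliptic with `Δ_W < 0`, no rational `2`-torsion abscissa, `β` a root of the `2`-division cubic,
three places above `2` in `ℚ(β)`: for every cyclotomic `ℤ₂`-extension `κP` of `ℚ(β)`, `μ = 0` (growth form, `ClassicalMuVanishes κP` — the per-seed
input H3M⁻ of att-p5 g24's cubic road) is EQUIVALENT to `1 ≤ classicalLambda κP`; in particular the cyclotomic `ℤ₂`-tower of `ℚ(β)` is never a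
`λ = μ = 0` tower. [cite: Lang1990, Ch. 5 §1 Thm. 1.2 and Ch. 13 §4 Lemma 4.1] [cite: Washington1997, §13.3 Thm. 13.13] [cite: Cohen1993, Prop. 4.8.11] -/
theorem classicalMuVanishes_iff_one_le_classicalLambda_seedCubicField (hΔ : W.Δ < 0) (ht : ∀ x : ℚ, ¬ HasRationalTwoTorsionX W x)
    {β : AlgebraicClosure ℚ} (hβ : aeval β W.twoTorsionPolynomial.toPoly = 0)
    (h3p : 3 ≤ {v : HeightOneSpectrum (𝓞 ↥(IntermediateField.adjoin ℚ ({β} : Set (AlgebraicClosure ℚ)))) |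
      ((2 : ℕ) : 𝓞 ↥(IntermediateField.adjoin ℚ ({β} : Set (AlgebraicClosure ℚ)))) ∈ v.asIdeal}.ncard)
    (κP : ZpExtension ↥(IntermediateField.adjoin ℚ ({β} : Set (AlgebraicClosure ℚ))) 2) (hκP : κP.IsCyclotomic) :
    ClassicalMuVanishes κP ↔ 1 ≤ classicalLambda κP := by
  have hirr := AlignedTransportAtTwoSeed.irr_two_of_forall_not_hasRationalTwoTorsionX W ht
  have hβint : IsIntegral ℚ β := ((AlgebraicClosure.isAlgebraic ℚ).isAlgebraic β).isIntegral
  haveI : FiniteDimensional ℚ ↥(IntermediateField.adjoin ℚ ({β} : Set (AlgebraicClosure ℚ))) :=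
    IntermediateField.adjoin.finiteDimensional hβint
  haveI : NumberField ↥(IntermediateField.adjoin ℚ ({β} : Set (AlgebraicClosure ℚ))) := NumberField.mk
  have h3 : Module.finrank ℚ ↥(IntermediateField.adjoin ℚ ({β} : Set (AlgebraicClosure ℚ))) = 3 :=
    AddKatoTwo.finrank_adjoin_root_twoTorsionPolynomial_eq_three W hirr hβ
  have h1 := nrRealPlaces_adjoin_root_twoTorsionPolynomial_eq_one W hΔ hirr hβ
  exact classicalMuVanishes_iff_one_le_classicalLambda_of_cubic _ h3 h1 h3p κP hκP

end Seed

end Summit.BirchSwinnertonDyer.BirchSwinnertonDyer.Theorems.AlignedTransportAtTwoCubicTowerLambda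

end
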